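import Summits.AtomisticToContinuum.Crystallization.Theorems.OverbindingBudgetEdgeRelaxationTyping

/-!
# OverbindingBudget — «EdgeRelaxation»: each typed relaxation law follows from the edge-relaxation law (decomp-a2c lens-4, generation 26)

Helper file (`--supports stmt-AtomisticToContinuum-31280`; statements in `…OverbindingBudgetEdgeRelaxationStatements`, the direction
«typed laws ⇒ RELAX» in `…OverbindingBudgetEdgeRelaxationTyping`).  Proved here, complete: a ball of type LONG / SHORT / LOWGAP / CONTRAST /
GAPCLASH at margin `t` contains a `t`-ROBUST violator of `RT a'` at EVERY admissible scale `a'` (margins `< min t (1/20)`; for the two-site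
types CONTRAST / GAPCLASH the robust site is picked by the monotonicity of `RT` in the margin, `rt_mono`), hence
`xRelaxationLaw_of_edgeRelaxationLaw : EdgeRelaxationLaw T₀ D → XRelaxationLaw T₀ D` for each of the five types (each child is
KERNEL-WEAKER than RELAX) and `edgeRelaxationLaw_iff_typed : T₀ ≤ 1/20 → (EdgeRelaxationLaw T₀ D ↔ the five typed laws)`.
-/

noncomputable section

namespace Summit.AtomisticToContinuum.Crystallization.Theorems.OverbindingBudgetEdgeRelaxationConverse

open Filter Metric Set Topology
open Literature.MathematicalPhysics.StatisticalMechanics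
open Summit.AtomisticToContinuum.Crystallization.Theorems.OverbindingBudgetViolatorDensityFloor (RT)
open Summit.AtomisticToContinuum.Crystallization.Theorems.OverbindingBudgetRecurrentDustStatements (ViolatorsL rt_mono)
open Summit.AtomisticToContinuum.Crystallization.Theorems.OverbindingBudgetEdgeRelaxationStatements
open Summit.AtomisticToContinuum.Crystallization.Theorems.OverbindingBudgetEdgeRelaxationTyping (edgeRelaxationLaw_of_typed)

/-! ## §L  Robust violators from types, and the converse implications -/

/-- A type-LONG ball has a `t`-robust violator at every admissible scale (margins `< min t (1/20)`). [this file] -/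
theorem violators_of_longAt {a' t L : ℝ} {Y : Set (EuclideanSpace ℝ (Fin 3))} {q : EuclideanSpace ℝ (Fin 3)} (ha'1 : 47 / 50 ≤ a')
    (ha'2 : a' ≤ 1) (h : LongAt t L Y q) :
    ∃ y ∈ Y, dist y q ≤ L ∧ ∀ s : ℝ, 0 < s → s < min t (1 / 20) → ¬ RT a' s Y y := by
  obtain ⟨y, hy, w, hw, hyq, hwy, hd, hlong⟩ := h
  refine ⟨y, hy, hyq, fun s hs hst hRT => ?_⟩
  have hst1 : s < t := lt_of_lt_of_le hst (min_le_left _ _)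
  have hs20 : s < 1 / 20 := lt_of_lt_of_le hst (min_le_right _ _)
  obtain ⟨-, -, h3⟩ := hRT
  obtain ⟨-, h | h⟩ := h3 w hw hwy
  · linarith
  · linarith

/-- A type-SHORT ball has a `t`-robust violator at every admissible scale. [this file] -/
theorem violators_of_shortAt {a' t L : ℝ} {Y : Set (EuclideanSpace ℝ (Fin 3))} {q : EuclideanSpace ℝ (Fin 3)} (ha'1 : 47 / 50 ≤ a')
    (h : ShortAt t L Y q) :
    ∃ y ∈ Y, dist y q ≤ L ∧ ∀ s : ℝ, 0 < s → s < min t (1 / 20) → ¬ RT a' s Y y := by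
  obtain ⟨y, hy, w, hw, hyq, hwy, hshort⟩ := h
  refine ⟨y, hy, hyq, fun s hs hst hRT => ?_⟩
  have hst1 : s < t := lt_of_lt_of_le hst (min_le_left _ _)
  obtain ⟨-, -, h3⟩ := hRT
  obtain ⟨h, -⟩ := h3 w hw hwy
  linarith

/-- A type-LOWGAP ball has a `t`-robust violator at every admissible scale. [this file] -/
theorem violators_of_lowGapAt {a' t L : ℝ} {Y : Set (EuclideanSpace ℝ (Fin 3))} {q : EuclideanSpace ℝ (Fin 3)} (ha'1 : 47 / 50 ≤ a')
    (ha'2 : a' ≤ 1) (h : LowGapAt t L Y q) :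
    ∃ y ∈ Y, dist y q ≤ L ∧ ∀ s : ℝ, 0 < s → s < min t (1 / 20) → ¬ RT a' s Y y := by
  obtain ⟨y, hy, w, hw, hyq, hfar, hlow⟩ := h
  have hwy : w ≠ y := by
    intro heq
    rw [heq, dist_self] at hfar
    linarith
  refine ⟨y, hy, hyq, fun s hs hst hRT => ?_⟩
  have hst1 : s < t := lt_of_lt_of_le hst (min_le_left _ _)
  have hs20 : s < 1 / 20 := lt_of_lt_of_le hst (min_le_right _ _)
  obtain ⟨-, -, h3⟩ := hRT
  obtain ⟨-, h | h⟩ := h3 w hw hwy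
  · linarith
  · linarith

/-- A type-CONTRAST ball has a `t`-robust violator at every admissible scale (one of the two sites, by monotonicity of `RT` in the
margin). [this file] -/
theorem violators_of_contrastAt {a' t L : ℝ} {Y : Set (EuclideanSpace ℝ (Fin 3))} {q : EuclideanSpace ℝ (Fin 3)} (hY : UniformlyDiscrete Y)
    (ha'1 : 47 / 50 ≤ a') (h : ContrastAt t L Y q) :
    ∃ y ∈ Y, dist y q ≤ L ∧ ∀ s : ℝ, 0 < s → s < min t (1 / 20) → ¬ RT a' s Y y := by
  obtain ⟨y, hy, w, hw, y₂, hy₂, w₂, hw₂, hyq, hy₂q, hwy, hwy₂, hd, hd₂, hcon⟩ := h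
  have key : ∀ s : ℝ, s < min t (1 / 20) → RT a' s Y y → RT a' s Y y₂ → False := by
    intro s hst h1 h2
    have hst1 : s < t := lt_of_lt_of_le hst (min_le_left _ _)
    have hs20 : s < 1 / 20 := lt_of_lt_of_le hst (min_le_right _ _)
    obtain ⟨-, -, h13⟩ := h1
    obtain ⟨-, -, h23⟩ := h2
    obtain ⟨hl, -⟩ := h23 w₂ hw₂ hwy₂
    obtain ⟨-, hu | hu⟩ := h13 w hw hwy
    · linarith
    · linarith
  by_cases hyv : ∀ s : ℝ, 0 < s → s < min t (1 / 20) → ¬ RT a' s Y y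
  · exact ⟨y, hy, hyq, hyv⟩
  · push Not at hyv
    obtain ⟨s₁, hs₁, hs₁t, hRT₁⟩ := hyv
    refine ⟨y₂, hy₂, hy₂q, fun s hs hst hRT => ?_⟩
    exact key (max s s₁) (max_lt hst hs₁t) (rt_mono hY (le_max_right _ _) hRT₁) (rt_mono hY (le_max_left _ _) hRT)

/-- A type-GAPCLASH ball has a `t`-robust violator at every admissible scale. [this file] -/
theorem violators_of_gapClashAt {a' t L : ℝ} {Y : Set (EuclideanSpace ℝ (Fin 3))} {q : EuclideanSpace ℝ (Fin 3)} (hY : UniformlyDiscrete Y)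
    (ha'1 : 47 / 50 ≤ a') (ha'2 : a' ≤ 1) (h : GapClashAt t L Y q) :
    ∃ y ∈ Y, dist y q ≤ L ∧ ∀ s : ℝ, 0 < s → s < min t (1 / 20) → ¬ RT a' s Y y := by
  obtain ⟨y, hy, w, hw, y₂, hy₂, w₂, hw₂, hyq, hy₂q, hwy, hd, hfar₂, hk⟩ := h
  have hwy₂ : w₂ ≠ y₂ := by
    intro heq
    rw [heq, dist_self] at hfar₂
    linarith
  have key : ∀ s : ℝ, s < min t (1 / 20) → RT a' s Y y → RT a' s Y y₂ → False := by
    intro s hst h1 h2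
    have hst1 : s < t := lt_of_lt_of_le hst (min_le_left _ _)
    have hs20 : s < 1 / 20 := lt_of_lt_of_le hst (min_le_right _ _)
    obtain ⟨-, -, h13⟩ := h1
    obtain ⟨-, -, h23⟩ := h2
    obtain ⟨-, hu | hu⟩ := h13 w hw hwy
    · obtain ⟨-, hv | hv⟩ := h23 w₂ hw₂ hwy₂
      · linarith
      · linarith
    · linarith
  by_cases hyv : ∀ s : ℝ, 0 < s → s < min t (1 / 20) → ¬ RT a' s Y y
  · exact ⟨y, hy, hyq, hyv⟩
  · push Not at hyv
    obtain ⟨s₁, hs₁, hs₁t, hRT₁⟩ := hyv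
    refine ⟨y₂, hy₂, hy₂q, fun s hs hst hRT => ?_⟩
    exact key (max s s₁) (max_lt hst hs₁t) (rt_mono hY (le_max_right _ _) hRT₁) (rt_mono hY (le_max_left _ _) hRT)

/-- `EdgeRelaxationLaw T₀ D → LongRelaxationLaw T₀ D` (typed law LONG is KERNEL-WEAKER than RELAX). [this file] -/
theorem longRelaxationLaw_of_edgeRelaxationLaw {T₀ D : ℝ} (h : EdgeRelaxationLaw T₀ D) : LongRelaxationLaw T₀ D :=
  fun Y hY t ht L hX => h Y hY (min t (1 / 20)) (lt_min ht (by norm_num)) L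
    fun a' h1 h2 q hq => violators_of_longAt h1 h2 (hX q hq)

/-- `EdgeRelaxationLaw T₀ D → ShortRelaxationLaw T₀ D`. [this file] -/
theorem shortRelaxationLaw_of_edgeRelaxationLaw {T₀ D : ℝ} (h : EdgeRelaxationLaw T₀ D) : ShortRelaxationLaw T₀ D :=
  fun Y hY t ht L hX => h Y hY (min t (1 / 20)) (lt_min ht (by norm_num)) L
    fun a' h1 _ q hq => violators_of_shortAt h1 (hX q hq)

/-- `EdgeRelaxationLaw T₀ D → LowGapRelaxationLaw T₀ D`. [this file] -/
theorem lowGapRelaxationLaw_of_edgeRelaxationLaw {T₀ D : ℝ} (h : EdgeRelaxationLaw T₀ D) : LowGapRelaxationLaw T₀ D :=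
  fun Y hY t ht L hX => h Y hY (min t (1 / 20)) (lt_min ht (by norm_num)) L
    fun a' h1 h2 q hq => violators_of_lowGapAt h1 h2 (hX q hq)

/-- `EdgeRelaxationLaw T₀ D → ContrastRelaxationLaw T₀ D`. [this file] -/
theorem contrastRelaxationLaw_of_edgeRelaxationLaw {T₀ D : ℝ} (h : EdgeRelaxationLaw T₀ D) : ContrastRelaxationLaw T₀ D :=
  fun Y hY t ht L hX => h Y hY (min t (1 / 20)) (lt_min ht (by norm_num)) L
    fun a' h1 _ q hq => violators_of_contrastAt hY.1 h1 (hX q hq)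

/-- `EdgeRelaxationLaw T₀ D → GapClashRelaxationLaw T₀ D`. [this file] -/
theorem gapClashRelaxationLaw_of_edgeRelaxationLaw {T₀ D : ℝ} (h : EdgeRelaxationLaw T₀ D) : GapClashRelaxationLaw T₀ D :=
  fun Y hY t ht L hX => h Y hY (min t (1 / 20)) (lt_min ht (by norm_num)) L
    fun a' h1 h2 q hq => violators_of_gapClashAt hY.1 h1 h2 (hX q hq)

/-- **RELAX ⟺ the five typed laws** (`T₀ ≤ 1/20`; in particular at the record `T₀ = 1/250`). [this file] -/
theorem edgeRelaxationLaw_iff_typed {T₀ D : ℝ} (hT₀ : T₀ ≤ 1 / 20) :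
    EdgeRelaxationLaw T₀ D ↔ LongRelaxationLaw T₀ D ∧ ShortRelaxationLaw T₀ D ∧ LowGapRelaxationLaw T₀ D ∧
      ContrastRelaxationLaw T₀ D ∧ GapClashRelaxationLaw T₀ D :=
  ⟨fun h => ⟨longRelaxationLaw_of_edgeRelaxationLaw h, shortRelaxationLaw_of_edgeRelaxationLaw h,
      lowGapRelaxationLaw_of_edgeRelaxationLaw h, contrastRelaxationLaw_of_edgeRelaxationLaw h,
      gapClashRelaxationLaw_of_edgeRelaxationLaw h⟩,
    fun h => edgeRelaxationLaw_of_typed hT₀ h.1 h.2.1 h.2.2.1 h.2.2.2.1 h.2.2.2.2⟩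

end Summit.AtomisticToContinuum.Crystallization.Theorems.OverbindingBudgetEdgeRelaxationConverse

end
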